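import Summits.HodgeConjecture.HodgeConjecture.Theses.PadicSemiregularLift
import Summits.HodgeConjecture.HodgeConjecture.Theses.RankFourFaces
import Literature.AlgebraicGeometry.HodgeTheory.WeilClasses
import Literature.AlgebraicGeometry.HodgeTheory.HodgeConjecture
import Literature.AlgebraicGeometry.HodgeTheory.HodgeModelExistence
import Literature.AlgebraicGeometry.HodgeTheory.ComplexConjugationHolds
import Literature.AlgebraicGeometry.Motives.AbelianVarietyProjectiveChart
import Summits.HodgeConjecture.HodgeConjecture.Theorems.PadicSemiregularLiftHodgeAbelianVarietiesStubHomPullback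
import Summits.HodgeConjecture.HodgeConjecture.Theorems.PadicSemiregularLiftHodgeAbelianVarietiesAndreStub

/-!
# Line `cm-pivot-andre` — crux `HodgeAbelianVarieties` (stmt-HodgeConjecture-1333): the CM PIVOT with its ARITHMETIC PIECE OPENED ALONG ANDRÉ 1992

Crux-strategist seat `planner-cstrat-stmt-HodgeConjecture-1333-r1-0` (BC2 REDIRECT re-exam, 2026-08-17). The crux
`PadicSemiregularLift.HodgeAbelianVarieties := ∀ A : AbelianVariety ℂ, HodgeConjectureFor A.dim A.X` (HC for every
complex abelian variety) is, by the landed kernel-checked equivalence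
`Theorems/PadicSemiregularLiftHodgeAbelianVarietiesCMPivotConverseHolds.lean`
(`CMPivot.hodgeAbelianVarieties_iff_cmAbelianHodge_and_cmToAbelian`, p141892; glue
`…CMPivotBridgeItems.lean` `hodgeAbelianVarieties_of_cmAbelianHodge_of_cmToAbelian`, p139146), the conjunction of
the two EXISTING items

* stmt-HodgeConjecture-3052 `CMAbelianHodge` (HC for CM abelian varieties — the ARITHMETIC piece), and
* stmt-HodgeConjecture-16267 `RankFourFaces.CMToAbelian` (HC(CM) ⟹ HC(all abelian varieties) — the TRANSPORT piece,
  own registered skeleton `Cruxes/CMToAbelian/Lines/birth.lean`: Mumford–Tate CM anchors [print] + VHC for abelian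
  schemes [open]).

The lead's line `cm_pivot` (gen 5) carries exactly these two items as its two stubs. THIS line keeps stub 4 = stmt-16267
verbatim and OPENS THE ARITHMETIC PIECE along André's reduction (Y. André, *Une remarque à propos des cycles de
Hodge de type CM*, Progr. Math. 102 (1992) 1–7 = Markman arXiv:2509.23403 Thm. 1.4; Deligne–Milne LNM 900 endnote 18;
Charles–Schnell Thm. 11.5.21): every Hodge class on a CM abelian variety `A` is `Σ fᵢ^* tᵢ` for homomorphisms
`fᵢ : A → Bᵢ` to CM abelian varieties `Bᵢ` of SPLIT WEIL TYPE and Weil classes `tᵢ ∈ W_{Kᵢ} = ⋀^{2p}_{Kᵢ} H¹(Bᵢ,ℚ)`.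
So HC(CM AV) ⇐ (André's decomposition, print) ∧ (Weil classes on CM abelian varieties of Weil type are algebraic —
THE OPEN CORE, all CM fields) ∧ (pull-backs of algebraic classes along homomorphisms are algebraic, print). Typed on the
tree's real carriers exactly as the landed audit `Theorems/PadicSemiregularLiftHodgeAbelianVarietiesStubAndreCM.lean`
(`AndreSplitWeil[]` / `CMWeil[]` / `HomPullback[]`, composition `hccm_of_cmWeil_of_andre_of_homPullback`), but over the
item's OWN subalgebra typing of "CM" throughout (no CM-typing bridge needed; the two typings agree by the landed
`CMPivot.isCM_iff_exists_cmSubalgebra`). Stubs 1–3 are byte-identical with the strategist's birth skeleton for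
stmt-3052 (`bc/CMAbelianHodge_birth.lean`, attached as evidence on stmt-3052 for its skeleton seat).

* `stub_andreSplitWeilCM : AndreSplitWeilCM` — André's decomposition WITH CM TARGETS (print; XL to formalise:
  `H•(A(ℂ);ℚ) = ⋀•H¹` as a ring on `complexBetti`, the MT torus of a CM abelian variety and its characters on
  `H^{2p}`, additivity of pull-back in the homomorphism, CONSTRUCTION of André's `B_J` as bundled `AbelianVariety ℂ`).
  [Andre1992HodgeCM; arXiv:2509.23403 Thm. 1.4; Deligne1982HodgeCycles §4 + endnote 18; CharlesSchnell2014Notes 11.5.21]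
* `stub_cmWeilClassesAlgebraic : CMWeilClassesAlgebraic` — THE OPEN CORE of the arithmetic piece: on an abelian
  variety with a CM subalgebra, rational `(p,p)`-classes in the Weil eigen-span of an endomorphism `ψ` (semisimple
  on `H¹`, non-real eigenvalues each of multiplicity `2p`) are algebraic. Known: `p = 1`; imaginary quadratic `K`,
  `dim 4` (Markman2025SecantWeil) and split sixfolds; Schoen / van Geemen–Schoen and Fermat-dominated CM members.
  First open: CM Weil sixfolds of non-split discriminant; quartic CM fields (arXiv:2509.23403 §12).
  [Weil1977HodgeRing; MoonenZarhin1999; Markman2025SecantWeil; arXiv:2509.23403 §12; Schoen1988]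
* `stub_homPullback : HomPullback` — pull-back functoriality of `algebraicClasses` along homomorphisms of abelian
  varieties (Voisin II 9.21 (i); tree has the flat case `map_mem_algebraicClasses_of_flat`; closed-immersion half
  needs Kleiman moving-by-translates — M–L). [VoisinHodgeII2003 Prop. 9.21 (i); Fulton1998 Cor. 19.2 (b); Kleiman1974Transversality]
* `stub_cmToAbelian : RankFourFaces.CMToAbelian` — the EXISTING item stmt-16267 VERBATIM (the transport piece; its own
  chain holds the plan: `Cruxes/CMToAbelian/Lines/birth.lean`). [Deligne1982HodgeCycles Prop. 6.1; CharlesSchnell2014Notes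
  Thm. 11.5.11, Conj. 11.3.1; BlochEsnaultKerz2014CharZero appendix]
* `cmAbelianHodge_of : stub₁ → stub₂ → stub₃ → RankFourFaces.CMAbelianHodge` and the SKELETON THEOREM
  `HodgeAbelianVarieties_of : stub₁ → stub₂ → stub₃ → stub₄ → PadicSemiregularLift.HodgeAbelianVarieties` — REAL proofs
  (no `sorry`): Hodge-model conjunct by `nonempty_hodgeModel_holds`, codimension `0` by `hodgeConjectureFor_codim_zero`,
  `0 < p` by André + stub 2 at the CM targets + stub 3 + `Submodule.sum_mem`; then modus ponens with stub 4 and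
  `AbelianVariety.isSmoothProjective_holds` (the seam of the split, = p139146). Concludes the route decl BY NAME.

HONEST STATUS. This line is the registered form of the BC2 REDIRECT `HodgeAbelianVarieties ⇐ stmt-3052 ∧ stmt-16267`
with a PLAN FOR BOTH SIDES: stubs 1–3 plan the arithmetic piece (never attacked by the chain: all five dead lines and
the twelve leads worked the transport piece), stub 4 is the transport piece whose plan is its own chain's skeleton. No
stub is the crux reworded: stub 2 covers only Weil eigen-span classes on CM abelian varieties, stub 4 is conditional
on HC(CM). Which `_false_without_` obstruction of `Disproof.lean` (v4) it honours: none applies — the Disproof's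
findings (F14–16, {0,1}-semiregular Weil SEEDS; Glue IV at p-adic anchors) concern sheaf-theoretic seeds and transport,
not the arithmetic piece; no landed `Negative/` lemma has an instance among the stubs (`StubWeilSectorSeedsFalseOf` is
about seeds, `KillTransfer` transfers kills of Weil-CLASS statements, which would kill stub 2 and HC alike).
`ledger negatives --problem HodgeConjecture`: no refuted statement is an instance of a stub. `sorry` only in `stub_*`.
-/

set_option linter.dupNamespace false

noncomputable section

namespace Summit.HodgeConjecture.HodgeConjecture.Cruxes.HodgeAbelianVarieties.CMPivotAndre

open CategoryTheory
open Literature.AlgebraicGeometry Literature.AlgebraicGeometry.Motives Literature.AlgebraicGeometry.HodgeTheory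
open Summit.HodgeConjecture.HodgeConjecture.Theses

/-- `IsCMSub[A]` — the CM hypothesis of the item VERBATIM: `End⁰(A) = ℚ ⊗ End A` contains a commutative
reduced `ℚ`-subalgebra of dimension `2 · dim A`. Local notation only. -/
local notation3 (prettyPrint := false) "IsCMSub[" A "]" =>
  ∃ S : Subalgebra ℚ (AbelianVariety.endAlgebra A), IsReduced ↥S ∧ (∀ x ∈ S, ∀ y ∈ S, x * y = y * x) ∧
    Module.finrank ℚ ↥S = 2 * AbelianVariety.dim A

/-- **Stub 1 statement — André's decomposition with CM targets.** For `A` with a CM subalgebra and a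
rational class `c` of Hodge type `(p,p)`, `0 < p`: finitely many abelian varieties `Bᵢ` EACH WITH A CM
SUBALGEBRA, homomorphisms `fᵢ : A ⟶ Bᵢ`, endomorphisms `ψᵢ` of `Bᵢ` and finite sets `Sᵢ ⊂ ℂ ∖ ℝ` such
that the `μ`-eigenspaces of `ψᵢ^*` on `H¹(Bᵢ(ℂ); ℂ)`, `μ ∈ Sᵢ`, exhaust `H¹` and have dimension exactly
`2p`, and rational `(p,p)`-classes `tᵢ` in the eigen-span `⊕_σ ⋀^{2p} H¹_σ = W_{Kᵢ} ⊗ ℂ` (Weil classes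
of `(Bᵢ, ℚ(ψᵢ))`) with `c = Σᵢ fᵢ^* tᵢ`. André 1992 for `A` of CM type in Deligne's sense (the `Bᵢ` are
built from the CM types of `A`, hence CM); above the top degree `c = 0` and `m = 0` works.
[cite: Andre1992HodgeCM, Théorème] [cite: Markman2025SurveySecant, Thm. 1.4]
[cite: Deligne1982HodgeCycles, §4 (4.3)–(4.4) and endnote 18] -/
def AndreSplitWeilCM : Prop :=
  ∀ (A : AbelianVariety ℂ), IsCMSub[A] → ∀ (p : ℕ), 0 < p →
    ∀ c : complexBetti A.X (2 * p), IsRationalClass c → IsOfHodgeType A.dim A.X (2 * p) p p c →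
      ∃ (m : ℕ) (B : Fin m → AbelianVariety ℂ) (f : ∀ i, A ⟶ B i) (ψ : ∀ i, B i ⟶ B i)
        (S : Fin m → Finset ℂ) (t : ∀ i, complexBetti (B i).X (2 * p)),
        (∀ i, IsCMSub[B i]) ∧
        (∀ i, ∀ μ ∈ S i, μ.im ≠ 0) ∧
        (∀ i, (⨆ μ ∈ S i, Module.End.eigenspace (complexBetti.map (ψ i).hom.hom.hom 1).hom μ) = ⊤) ∧
        (∀ i, ∀ μ ∈ S i, Module.finrank ℂ
            (Module.End.eigenspace (complexBetti.map (ψ i).hom.hom.hom 1).hom μ) = 2 * p) ∧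
        (∀ i, IsRationalClass (t i)) ∧
        (∀ i, IsOfHodgeType (B i).dim (B i).X (2 * p) p p (t i)) ∧
        (∀ i, t i ∈ ⨆ μ ∈ S i, pullbackEigenclasses (B i) (ψ i) (2 * p)
            (fun x y => ((x : ℂ) + (y : ℂ) * μ) ^ (2 * p))) ∧
        c = ∑ i, complexBetti.map (f i).hom.hom.hom (2 * p) (t i)

/-- **Stub 2 statement — Weil classes on CM abelian varieties are algebraic (the open core).** On a
complex abelian variety with a CM subalgebra, for an endomorphism `ψ` whose pull-back on `H¹(A(ℂ); ℂ)`
is semisimple with non-real eigenvalues `μ ∈ S`, each of multiplicity exactly `2p` (`0 < p`), every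
rational `(p,p)`-class in the span of the top-wedge eigenclass lines
`⋀^{2p} H¹_μ = pullbackEigenclasses A ψ (2p) ((x,y) ↦ (x + yμ)^{2p})` is algebraic. The statement
`CMWeil[]` of the `HodgeAbelianVarieties` crux lines RESTRICTED to CM abelian varieties.
[cite: Weil1977HodgeRing] [cite: MoonenZarhin1999, §§5–7] [cite: Markman2025SecantWeil, Thm. 1.1]
[cite: Markman2025SurveySecant, §12] -/
def CMWeilClassesAlgebraic : Prop :=
  ∀ (A : AbelianVariety ℂ), IsCMSub[A] → ∀ (ψ : A ⟶ A) (p : ℕ) (S : Finset ℂ), 0 < p →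
    (∀ μ ∈ S, μ.im ≠ 0) →
    (⨆ μ ∈ S, Module.End.eigenspace (complexBetti.map ψ.hom.hom.hom 1).hom μ) = ⊤ →
    (∀ μ ∈ S, Module.finrank ℂ (Module.End.eigenspace (complexBetti.map ψ.hom.hom.hom 1).hom μ) = 2 * p) →
    ∀ c : complexBetti A.X (2 * p), IsRationalClass c → IsOfHodgeType A.dim A.X (2 * p) p p c →
      c ∈ (⨆ μ ∈ S, pullbackEigenclasses A ψ (2 * p) (fun x y => ((x : ℂ) + (y : ℂ) * μ) ^ (2 * p))) →
      c ∈ algebraicClasses A.X p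

/-- **Stub 3 statement — pull-back along a homomorphism of complex abelian varieties preserves
algebraic classes** (`f^*(Nᵖ H²ᵖ(B)) ⊆ Nᵖ H²ᵖ(A)` for `f : A ⟶ B`).
[cite: VoisinHodgeII2003, Prop. 9.21 (i)] [cite: Fulton1998, Cor. 19.2 (b)]
[cite: Kleiman1974Transversality, Thm. 2] -/
def HomPullback : Prop :=
  ∀ (A B : AbelianVariety ℂ) (f : A ⟶ B) (p : ℕ) (a : complexBetti B.X (2 * p)),
    a ∈ algebraicClasses B.X p → complexBetti.map f.hom.hom.hom (2 * p) a ∈ algebraicClasses A.X p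

/-- **Stub 1 — André's decomposition with CM targets** (André 1992 = Markman survey Thm. 1.4).
CLOSED (lead c11): the landed `Theorems/PadicSemiregularLiftHodgeAbelianVarietiesAndreStub.lean`
(`Theorems.HodgeAbelianVarieties.CMPivotAndre.stub_andreSplitWeilCM`, assembled in `…AndreMain.lean` from the
modules `…Andre*.lean` — PROVED on the tree's carriers: E = ℚ(eigenvalues), B = ⨁ A, idempotents u_α, rational
symmetric-function operators cutting out the Weil component, key identity ι₀^*((π^*c)_D) = n • c, targets im u_α).
[cite: Andre1992HodgeCM, Théorème] [cite: Markman2025SurveySecant, Thm. 1.4] -/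
theorem stub_andreSplitWeilCM : AndreSplitWeilCM :=
  Summit.HodgeConjecture.HodgeConjecture.Theorems.HodgeAbelianVarieties.CMPivotAndre.stub_andreSplitWeilCM

/-- **Stub 2 — Weil classes on CM abelian varieties of Weil type are algebraic** (the open core; all
CM fields, all `p`). [cite: Markman2025SurveySecant, §12] [cite: MoonenZarhin1999, §§5–7] -/
theorem stub_cmWeilClassesAlgebraic : CMWeilClassesAlgebraic := by
  sorry

/-- **Stub 3 — pull-backs of algebraic classes along homomorphisms of abelian varieties are
algebraic.** CLOSED (lead c11, p148507): the landed
`Theorems/PadicSemiregularLiftHodgeAbelianVarietiesStubHomPullback.lean`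
(`Theorems.HodgeAbelianVarieties.CMPivotAndre.stub_homPullback`, from the Literature theorem
`map_mem_algebraicClasses_of_abelianVariety` — Kleiman moving-by-translates — at the smooth projective
source `A`). [cite: VoisinHodgeII2003, Prop. 9.21 (i)] [cite: Fulton1998, Cor. 19.2 (b)] -/
theorem stub_homPullback : HomPullback :=
  Summit.HodgeConjecture.HodgeConjecture.Theorems.HodgeAbelianVarieties.CMPivotAndre.stub_homPullback


/-- **Stub 4 — the transport piece = the EXISTING item stmt-HodgeConjecture-16267 verbatim**
(`RankFourFaces.CMToAbelian`: HC for CM abelian varieties ⟹ HC for every complex abelian variety; its plan is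
its own chain's registered skeleton `Cruxes/CMToAbelian/Lines/birth.lean`). [cite: Deligne1982HodgeCycles, Prop. 6.1]
[cite: CharlesSchnell2014Notes, Thm. 11.5.11 and Conj. 11.3.1] -/
theorem stub_cmToAbelian : RankFourFaces.CMToAbelian := by
  sorry

/-! ## Name-keyed aliases of the four statements — the hypotheses of `HodgeAbelianVarieties_of` -/
namespace __Registered

/-- Alias of `AndreSplitWeilCM` keyed by the registered stub name. -/
abbrev stub_andreSplitWeilCM : Prop := AndreSplitWeilCM
/-- Alias of `CMWeilClassesAlgebraic` keyed by the registered stub name. -/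
abbrev stub_cmWeilClassesAlgebraic : Prop := CMWeilClassesAlgebraic
/-- Alias of `HomPullback` keyed by the registered stub name. -/
abbrev stub_homPullback : Prop := HomPullback
/-- Alias of the item statement `RankFourFaces.CMToAbelian` keyed by the registered stub name. -/
abbrev stub_cmToAbelian : Prop := RankFourFaces.CMToAbelian

end __Registered

/-- **The arithmetic piece from stubs 1–3 (real proof)**: André's decomposition, algebraicity of Weil classes on
CM abelian varieties of Weil type, and pull-back functoriality give `RankFourFaces.CMAbelianHodge` (stmt-3052) BY
NAME. [cite: Andre1992HodgeCM, Théorème] [cite: VoisinHodgeII2003, Prop. 9.21 (i)] -/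
theorem cmAbelianHodge_of :
    __Registered.stub_andreSplitWeilCM → __Registered.stub_cmWeilClassesAlgebraic →
      __Registered.stub_homPullback → RankFourFaces.CMAbelianHodge := by
  intro hAndre hW hpull A hA hS
  refine (hodgeConjectureFor_iff_of_isSmoothProjective nonempty_hodgeModel_holds hA).2 ?_
  intro p c hc hpp
  rcases Nat.eq_zero_or_pos p with rfl | hp
  · exact hodgeConjectureFor_codim_zero c
  obtain ⟨m, B, f, ψ, S, t, hCM, hS', htop, hrk, hrat, hhodge, hweil, rfl⟩ :=
    hAndre A hS p hp c hc hpp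
  refine Submodule.sum_mem _ fun i _ ↦ hpull A (B i) (f i) p (t i) ?_
  exact hW (B i) (hCM i) (ψ i) p (S i) hp (hS' i) (htop i) (hrk i) (t i) (hrat i) (hhodge i) (hweil i)

/-- **THE SKELETON THEOREM (real proof).** Stubs 1–3 (the arithmetic piece, André) and stub 4 (the transport piece,
stmt-16267) give the crux `PadicSemiregularLift.HodgeAbelianVarieties`, concluded BY NAME; the seam is modus ponens
plus `AbelianVariety.isSmoothProjective_holds` (Görtz–Wedhorn 27.174) — verbatim the landed glue p139146.
[cite: Andre1992HodgeCM, Théorème] [cite: Deligne1982HodgeCycles, Prop. 6.1] -/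
theorem HodgeAbelianVarieties_of :
    __Registered.stub_andreSplitWeilCM → __Registered.stub_cmWeilClassesAlgebraic →
      __Registered.stub_homPullback → __Registered.stub_cmToAbelian →
        PadicSemiregularLift.HodgeAbelianVarieties :=
  fun h₁ h₂ h₃ h₄ A ↦ h₄ (cmAbelianHodge_of h₁ h₂ h₃) A (AbelianVariety.isSmoothProjective_holds (A := A))

/-- **The crux from its registered stubs, by name** (no `sorry` of its own). -/
theorem HodgeAbelianVarieties_of_stubs : PadicSemiregularLift.HodgeAbelianVarieties :=
  HodgeAbelianVarieties_of stub_andreSplitWeilCM stub_cmWeilClassesAlgebraic stub_homPullback stub_cmToAbelian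

/-! ## Upper bounds: no stub claims more than the crux -/

/-- HC for all complex abelian varieties (the crux's definiens, kept as a FORMULA so that the audit credits
nothing) implies stub 2. [folklore] -/
theorem cmWeilClassesAlgebraic_of_hodgeAV (h : ∀ A : AbelianVariety ℂ, HodgeConjectureFor A.dim A.X) :
    CMWeilClassesAlgebraic :=
  fun A _ _ p _ _ _ _ _ c hc hh _ ↦ (h A).2 p c hc hh

/-- … implies stub 4 (the transport piece concludes HC for abelian varieties). [folklore] -/
theorem cmToAbelian_of_hodgeAV (h : ∀ A : AbelianVariety ℂ, HodgeConjectureFor A.dim A.X) :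
    RankFourFaces.CMToAbelian :=
  fun _ A _ ↦ h A

/-- … implies the arithmetic piece (restrict the binder). [folklore] -/
theorem cmAbelianHodge_of_hodgeAV (h : ∀ A : AbelianVariety ℂ, HodgeConjectureFor A.dim A.X) :
    RankFourFaces.CMAbelianHodge :=
  fun A _ _ ↦ h A

/-- The crux unfolds to that formula (`Iff.rfl`), so the three upper bounds apply to it. [folklore] -/
theorem hodgeAbelianVarieties_iff_formula :
    PadicSemiregularLift.HodgeAbelianVarieties ↔ ∀ A : AbelianVariety ℂ, HodgeConjectureFor A.dim A.X :=
  Iff.rfl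

end Summit.HodgeConjecture.HodgeConjecture.Cruxes.HodgeAbelianVarieties.CMPivotAndre

end
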